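import Mathlib.NumberTheory.Chebyshev
import Mathlib.NumberTheory.AbelSummation
import Mathlib.Analysis.SpecialFunctions.Integrals.Basic
import HarnessLib

/-!
# A lower bound for the prime-square tail `∑_{Q < p ≤ P} 1/p²` from two-sided bounds on `θ`

Trunk T-ANT (`NumberTheory/LFunctions`). Partial summation against Chebyshev's `θ` (Mathlib
`Chebyshev.theta`, Abel summation `sum_mul_eq_sub_sub_integral_mul`), in the shape needed to lower
the threshold of the analytic half of Robin's criterion (`RobinAnalytic.lean`, provefact
`Literature.NumberTheory.LFunctions.robin_iff`; Robin 1984, §3 bounds `∏_{x₂ < p ≤ x}(1 − 1/p²)` this way under RH).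
Everything here is PROVED from Mathlib alone; the `θ`-bounds enter as hypotheses, so that any
explicit estimate (`Schoenfeld1976_theta` under RH, or unconditional ones) can be plugged in.

* `sum_inv_sq_eq` : for real `2 ≤ Q ≤ P`,
  `∑_{Q < p ≤ P} 1/p² = θ(P)/(P² log P) − θ(Q)/(Q² log Q) + ∫_Q^P θ(t)(2 log t + 1)/(t³ log² t) dt`;
* `integral_log_add_one_div` : `∫_Q^P (log t + 1) dt/(t² log² t) = 1/(Q log Q) − 1/(P log P)`;
* `le_sum_inv_sq` : if `(1 − δ) t ≤ θ(t)` on `[Q, P]` and `θ(Q) ≤ (1 + δ) Q` (`δ ≤ 1`), then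
  `∑_{Q < p ≤ P} 1/p² ≥ (1 − δ)·(log Q/(log Q + 1))·(1/(Q log Q) − 1/(P log P)) − 2δ/(Q log Q)`.

The main term `1/(Q log Q)` is the classical size of `∑_{p > Q} 1/p²`; the factor `log Q/(log Q + 1)`
is the loss from bounding `∫_Q^P dt/(t² log t)` below through the exact derivative
`(log t + 1)/(t² log² t)` of `−1/(t log t)`, and `2δ/(Q log Q)` is the boundary loss forced by a
sup-norm hypothesis on `θ(t) − t`.

## References

* G. Robin, *Grandes valeurs de la fonction somme des diviseurs et hypothèse de Riemann*, J. Math.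
  Pures Appl. 63 (1984), 187–213, §3 (the bound for `∏_{x₂ < p ≤ x}(1 − 1/p²)`, quoted as (30) in
  arXiv:2008.04787, §3). [Robin1984]
* G. H. Hardy, E. M. Wright, *An Introduction to the Theory of Numbers*, 6th ed., Thm 421 (§22.5,
  partial summation). [HardyWright2008]

## Mathlib

`Chebyshev.theta`, `Chebyshev.theta_eq_sum_Icc`, `sum_mul_eq_sub_sub_integral_mul`,
`integrableOn_mul_sum_Icc`, `intervalIntegral.integral_eq_sub_of_hasDerivAt`. Mathlib's
`Chebyshev.primeCounting_eq_theta_div_log_add_integral` is the same computation for `∑_{p ≤ x} 1`.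
-/
noncomputable section

open Filter Topology Set MeasureTheory Finset Real
open scoped Chebyshev

namespace Literature.NumberTheory.LFunctions.PrimeSquareTail

/-- Auxiliary (proof-internal): `∑_{0 ≤ k ≤ ⌊t⌋} [k prime] log k = θ(t)`. [folklore] -/
theorem sum_Icc_ite_prime_log (t : ℝ) :
    ∑ k ∈ Icc 0 ⌊t⌋₊, (if k.Prime then Real.log k else 0) = θ t := by
  rw [Chebyshev.theta_eq_sum_Icc, Finset.sum_filter]

/-- **Partial summation for `∑_{Q < p ≤ P} 1/p²` against `θ`**: for real `2 ≤ Q ≤ P`,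
`∑_{Q < p ≤ P} 1/p² = θ(P)/(P² log P) − θ(Q)/(Q² log Q) + ∫_Q^P θ(t) (2 log t + 1)/(t³ log² t) dt`
(Mathlib's Abel summation `sum_mul_eq_sub_sub_integral_mul` with `c_p = log p`,
`f(t) = 1/(t² log t)`). [folklore] -/
theorem sum_inv_sq_eq {Q P : ℝ} (hQ : 2 ≤ Q) (hQP : Q ≤ P) :
    ∑ p ∈ (Finset.Ioc ⌊Q⌋₊ ⌊P⌋₊).filter Nat.Prime, ((p : ℝ) ^ 2)⁻¹ =
      θ P / (P ^ 2 * Real.log P) - θ Q / (Q ^ 2 * Real.log Q) +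
        ∫ t in Set.Ioc Q P, θ t * ((2 * Real.log t + 1) / (t ^ 3 * Real.log t ^ 2)) := by
  have hQ0 : (0 : ℝ) ≤ Q := by linarith
  set c : ℕ → ℝ := fun k => if k.Prime then Real.log k else 0 with hc
  set f : ℝ → ℝ := fun t => (t ^ 2 * Real.log t)⁻¹ with hf
  set g : ℝ → ℝ := fun t => -((2 * Real.log t + 1) / (t ^ 3 * Real.log t ^ 2)) with hg
  have hderiv : ∀ t : ℝ, 1 < t → HasDerivAt f (g t) t := by
    intro t ht
    have ht0 : t ≠ 0 := by linarith
    have hl : Real.log t ≠ 0 := (Real.log_pos ht).ne'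
    have h1 : HasDerivAt (fun t : ℝ ↦ t ^ 2 * Real.log t) (↑2 * t ^ (2 - 1) * Real.log t + t ^ 2 * t⁻¹) t :=
      (hasDerivAt_pow 2 t).mul (Real.hasDerivAt_log ht0)
    have h2 := h1.inv (mul_ne_zero (pow_ne_zero _ ht0) hl)
    refine h2.congr_deriv ?_
    simp only [hg]
    field_simp
    ring
  have hmem : ∀ t ∈ Set.Icc Q P, t ∈ ({0}ᶜ : Set ℝ) := fun t ht =>
    Set.mem_compl_singleton_iff.mpr (show (0 : ℝ) < t by linarith [ht.1]).ne'
  have hlogne : ∀ t ∈ Set.Icc Q P, Real.log t ≠ 0 := fun t ht =>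
    (Real.log_pos (by linarith [ht.1])).ne'
  have hgcont : ContinuousOn g (Set.Icc Q P) := by
    refine ContinuousOn.neg (ContinuousOn.div ?_ ?_ fun t ht => ?_)
    · exact (continuousOn_const.mul (Real.continuousOn_log.mono hmem)).add continuousOn_const
    · exact (continuousOn_pow 3).mul ((Real.continuousOn_log.mono hmem).pow 2)
    · have : (0 : ℝ) < t := by linarith [ht.1]
      exact mul_ne_zero (pow_ne_zero _ this.ne') (pow_ne_zero _ (hlogne t ht))
  have hf_diff : ∀ t ∈ Set.Icc Q P, DifferentiableAt ℝ f t := fun t ht =>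
    (hderiv t (by linarith [ht.1])).differentiableAt
  have hderiv_eq : Set.EqOn g (deriv f) (Set.Icc Q P) := fun t ht =>
    ((hderiv t (by linarith [ht.1])).deriv).symm
  have hg_int : IntegrableOn g (Set.Icc Q P) := hgcont.integrableOn_Icc
  have hf_int : IntegrableOn (deriv f) (Set.Icc Q P) :=
    hg_int.congr_fun hderiv_eq measurableSet_Icc
  have habel := sum_mul_eq_sub_sub_integral_mul c hQ0 hQP hf_diff hf_int
  -- left-hand side
  have hlhs : ∑ k ∈ Finset.Ioc ⌊Q⌋₊ ⌊P⌋₊, f k * c k =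
      ∑ p ∈ (Finset.Ioc ⌊Q⌋₊ ⌊P⌋₊).filter Nat.Prime, ((p : ℝ) ^ 2)⁻¹ := by
    rw [Finset.sum_filter]
    refine Finset.sum_congr rfl fun k _ => ?_
    simp only [hf, hc]
    split_ifs with hk
    · have hk1 : (1 : ℝ) < k := by exact_mod_cast hk.one_lt
      have hl : Real.log k ≠ 0 := (Real.log_pos hk1).ne'
      have hk0 : (k : ℝ) ≠ 0 := by positivity
      field_simp
    · simp
  -- partial sums
  have hS : ∀ t : ℝ, ∑ k ∈ Icc 0 ⌊t⌋₊, c k = θ t := fun t ↦ by rw [hc, sum_Icc_ite_prime_log]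
  have hint : ∫ t in Set.Ioc Q P, deriv f t * ∑ k ∈ Icc 0 ⌊t⌋₊, c k =
      -∫ t in Set.Ioc Q P, θ t * ((2 * Real.log t + 1) / (t ^ 3 * Real.log t ^ 2)) := by
    rw [← integral_neg]
    refine setIntegral_congr_fun measurableSet_Ioc fun t ht => ?_
    rw [← hderiv_eq (Set.Ioc_subset_Icc_self ht), hS, hg]
    ring
  rw [← hlhs, habel, hS, hS, hint]
  simp only [hf, div_eq_mul_inv]
  ring

/-- `∫_Q^P (log t + 1)/(t² log² t) dt = 1/(Q log Q) − 1/(P log P)` (the derivative of `−1/(t log t)`).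
[folklore] -/
theorem integral_log_add_one_div {Q P : ℝ} (hQ : 2 ≤ Q) (hQP : Q ≤ P) :
    ∫ t in Set.Ioc Q P, (Real.log t + 1) / (t ^ 2 * Real.log t ^ 2) =
      1 / (Q * Real.log Q) - 1 / (P * Real.log P) := by
  have hderiv : ∀ t : ℝ, 1 < t →
      HasDerivAt (fun t : ℝ ↦ -(t * Real.log t)⁻¹) ((Real.log t + 1) / (t ^ 2 * Real.log t ^ 2)) t := by
    intro t ht
    have ht0 : t ≠ 0 := by linarith
    have hl : Real.log t ≠ 0 := (Real.log_pos ht).ne'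
    have h1 : HasDerivAt (fun t : ℝ ↦ t * Real.log t) (1 * Real.log t + t * t⁻¹) t :=
      (hasDerivAt_id t).mul (Real.hasDerivAt_log ht0)
    have h2 := (h1.inv (mul_ne_zero ht0 hl)).neg
    refine h2.congr_deriv ?_
    field_simp
  have hmem : ∀ t ∈ Set.Icc Q P, t ∈ ({0}ᶜ : Set ℝ) := fun t ht =>
    Set.mem_compl_singleton_iff.mpr (show (0 : ℝ) < t by linarith [ht.1]).ne'
  have hlogne : ∀ t ∈ Set.Icc Q P, Real.log t ≠ 0 := fun t ht =>
    (Real.log_pos (by linarith [ht.1])).ne'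
  have hcont : ContinuousOn (fun t : ℝ ↦ (Real.log t + 1) / (t ^ 2 * Real.log t ^ 2)) (Set.Icc Q P) := by
    refine ContinuousOn.div ((Real.continuousOn_log.mono hmem).add continuousOn_const)
      ((continuousOn_pow 2).mul ((Real.continuousOn_log.mono hmem).pow 2)) fun t ht => ?_
    have : (0 : ℝ) < t := by linarith [ht.1]
    exact mul_ne_zero (pow_ne_zero _ this.ne') (pow_ne_zero _ (hlogne t ht))
  have hFTC := intervalIntegral.integral_eq_sub_of_hasDerivAt
    (fun t ht => hderiv t (by rw [Set.uIcc_of_le hQP] at ht; linarith [ht.1]))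
    ((hcont.mono (by rw [Set.uIcc_of_le hQP])).intervalIntegrable)
  rw [← intervalIntegral.integral_of_le hQP, hFTC]
  simp only [one_div, mul_inv_rev]
  ring

/-- **Lower bound for `∑_{Q < p ≤ P} 1/p²` from a two-sided bound on `θ`**: if `(1−δ)t ≤ θ(t)` on
`[Q, P]` and `θ(Q) ≤ (1+δ)Q` (`0 ≤ δ ≤ 1`, `2 ≤ Q ≤ P`), then
`∑_{Q < p ≤ P} 1/p² ≥ (1−δ)·(log Q/(log Q + 1))·(1/(Q log Q) − 1/(P log P)) − 2δ/(Q log Q)`.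
Proof: partial summation (`sum_inv_sq_eq`), `θ ≥ (1−δ)t` inside the integral,
`(2 log t + 1)/(log t + 1) ≥ (2 log Q + 1)/(log Q + 1)` for `t ≥ Q`, and
`∫_Q^P (log t + 1) dt/(t² log² t) = 1/(Q log Q) − 1/(P log P)`. This is the prime-square tail
estimate of Robin 1984, §3 (there `∏_{√(2x) < p ≤ x}(1 − 1/p²) ≤ exp(−√2/(√x log x) + 4/(√x log² x))`
under RH) in a form taking the `θ`-bounds as hypotheses (`δ ≤ 1`; `δ ≥ 0` is not needed). [folklore] -/
theorem le_sum_inv_sq {Q P δ : ℝ} (hQ : 2 ≤ Q) (hQP : Q ≤ P) (hδ1 : δ ≤ 1)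
    (hθl : ∀ t ∈ Set.Icc Q P, (1 - δ) * t ≤ θ t) (hθQ : θ Q ≤ (1 + δ) * Q) :
    (1 - δ) * (Real.log Q / (Real.log Q + 1)) * (1 / (Q * Real.log Q) - 1 / (P * Real.log P))
        - 2 * δ / (Q * Real.log Q) ≤
      ∑ p ∈ (Finset.Ioc ⌊Q⌋₊ ⌊P⌋₊).filter Nat.Prime, ((p : ℝ) ^ 2)⁻¹ := by
  have hQ0 : (0 : ℝ) < Q := by linarith
  have hP0 : (0 : ℝ) < P := by linarith
  have hlQ : 0 < Real.log Q := Real.log_pos (by linarith)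
  have hlP : 0 < Real.log P := Real.log_pos (by linarith)
  have hlQP : Real.log Q ≤ Real.log P := Real.log_le_log hQ0 hQP
  rw [sum_inv_sq_eq hQ hQP]
  -- (1) boundary terms
  have hbP : (1 - δ) / (P * Real.log P) ≤ θ P / (P ^ 2 * Real.log P) := by
    have h := mul_le_mul_of_nonneg_right (hθl P ⟨hQP, le_rfl⟩)
      (by positivity : (0 : ℝ) ≤ P * Real.log P)
    rw [div_le_div_iff₀ (by positivity) (by positivity)]
    calc (1 - δ) * (P ^ 2 * Real.log P) = (1 - δ) * P * (P * Real.log P) := by ring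
      _ ≤ θ P * (P * Real.log P) := h
  have hbQ : θ Q / (Q ^ 2 * Real.log Q) ≤ (1 + δ) / (Q * Real.log Q) := by
    have h := mul_le_mul_of_nonneg_right hθQ (by positivity : (0 : ℝ) ≤ Q * Real.log Q)
    rw [div_le_div_iff₀ (by positivity) (by positivity)]
    calc θ Q * (Q * Real.log Q) ≤ (1 + δ) * Q * (Q * Real.log Q) := h
      _ = (1 + δ) * (Q ^ 2 * Real.log Q) := by ring
  -- (2) the integral: `θ(t) ≥ (1−δ)t` and `(2 log t + 1)/(log t + 1) ≥ (2 log Q + 1)/(log Q + 1)`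
  have hmem : ∀ t ∈ Set.Icc Q P, t ∈ ({0}ᶜ : Set ℝ) := fun t ht =>
    Set.mem_compl_singleton_iff.mpr (show (0 : ℝ) < t by linarith [ht.1]).ne'
  have hlogne : ∀ t ∈ Set.Icc Q P, Real.log t ≠ 0 := fun t ht =>
    (Real.log_pos (by linarith [ht.1])).ne'
  have hw1 : ContinuousOn (fun t : ℝ ↦ (Real.log t + 1) / (t ^ 2 * Real.log t ^ 2)) (Set.Icc Q P) := by
    refine ContinuousOn.div ((Real.continuousOn_log.mono hmem).add continuousOn_const)
      ((continuousOn_pow 2).mul ((Real.continuousOn_log.mono hmem).pow 2)) fun t ht => ?_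
    have : (0 : ℝ) < t := by linarith [ht.1]
    exact mul_ne_zero (pow_ne_zero _ this.ne') (pow_ne_zero _ (hlogne t ht))
  have hw2 : ContinuousOn (fun t : ℝ ↦ (2 * Real.log t + 1) / (t ^ 3 * Real.log t ^ 2)) (Set.Icc Q P) := by
    refine ContinuousOn.div ?_ ((continuousOn_pow 3).mul ((Real.continuousOn_log.mono hmem).pow 2))
      fun t ht => ?_
    · exact (continuousOn_const.mul (Real.continuousOn_log.mono hmem)).add continuousOn_const
    · have : (0 : ℝ) < t := by linarith [ht.1]
      exact mul_ne_zero (pow_ne_zero _ this.ne') (pow_ne_zero _ (hlogne t ht))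
  set K : ℝ := (2 * Real.log Q + 1) / (Real.log Q + 1) with hK
  have hK0 : 0 ≤ K := by positivity
  have hθint : IntegrableOn (fun t ↦ θ t * ((2 * Real.log t + 1) / (t ^ 3 * Real.log t ^ 2)))
      (Set.Ioc Q P) := by
    have h := integrableOn_mul_sum_Icc (fun k => if k.Prime then Real.log k else 0) (m := 0) hQ0.le
      (hw2.integrableOn_Icc)
    refine (h.mono_set Set.Ioc_subset_Icc_self).congr_fun (fun t _ ↦ ?_) measurableSet_Ioc
    simp only [sum_Icc_ite_prime_log]
    ring
  have hlow : (1 - δ) * K * (1 / (Q * Real.log Q) - 1 / (P * Real.log P)) ≤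
      ∫ t in Set.Ioc Q P, θ t * ((2 * Real.log t + 1) / (t ^ 3 * Real.log t ^ 2)) := by
    rw [← integral_log_add_one_div hQ hQP, ← integral_const_mul]
    refine setIntegral_mono_on ((hw1.integrableOn_Icc.mono_set Set.Ioc_subset_Icc_self).const_mul _)
      hθint measurableSet_Ioc fun t ht => ?_
    have htQ : Q ≤ t := ht.1.le
    have ht0 : 0 < t := by linarith [ht.1]
    have hlt : Real.log Q ≤ Real.log t := Real.log_le_log hQ0 htQ
    have hltpos : 0 < Real.log t := hlQ.trans_le hlt
    have hθt : (1 - δ) * t ≤ θ t := hθl t ⟨htQ, ht.2⟩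
    -- `(1−δ) K (log t + 1)/(t² log² t) ≤ (1−δ) t (2 log t + 1)/(t³ log² t) ≤ θ(t) (…)`
    have hKt : K * (Real.log t + 1) ≤ 2 * Real.log t + 1 := by
      rw [hK, div_mul_eq_mul_div, div_le_iff₀ (by positivity)]
      nlinarith
    have hpos : 0 ≤ (2 * Real.log t + 1) / (t ^ 3 * Real.log t ^ 2) := by positivity
    calc (1 - δ) * K * ((Real.log t + 1) / (t ^ 2 * Real.log t ^ 2))
        = (1 - δ) * t * ((K * (Real.log t + 1)) / (t ^ 3 * Real.log t ^ 2)) := by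
          field_simp
      _ ≤ (1 - δ) * t * ((2 * Real.log t + 1) / (t ^ 3 * Real.log t ^ 2)) := by
          have h1 : 0 ≤ (1 - δ) * t := by nlinarith
          exact mul_le_mul_of_nonneg_left (div_le_div_of_nonneg_right hKt (by positivity)) h1
      _ ≤ θ t * ((2 * Real.log t + 1) / (t ^ 3 * Real.log t ^ 2)) :=
          mul_le_mul_of_nonneg_right hθt hpos
  -- (3) assemble: `(1−δ)(K − 1) = (1−δ) log Q/(log Q + 1)`
  have hKid : (1 - δ) * (Real.log Q / (Real.log Q + 1)) * (1 / (Q * Real.log Q) - 1 / (P * Real.log P))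
      - 2 * δ / (Q * Real.log Q) =
      (1 - δ) / (P * Real.log P) - (1 + δ) / (Q * Real.log Q) +
        (1 - δ) * K * (1 / (Q * Real.log Q) - 1 / (P * Real.log P)) := by
    rw [hK]
    field_simp
    ring
  rw [hKid]
  linarith

end Literature.NumberTheory.LFunctions.PrimeSquareTail
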